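import Mathlib

/-!
# Definitions for the rank certificate of line `four-row-count` (crux `ValuativeGCT.HeadFlip`)

Crux `ValuativeGCT.HeadFlip` (stmt-ValiantsHypothesis-15535), line `four-row-count`
(`Cruxes/HeadFlip/Lines/four_row_count.lean`), registered stub `stub_rankBound`: a `(2+ε)n²` lower
bound for the dimension of the span of the `4n²` products `y_t · Per_ij(M(y))`, where
`M(y) = diag(d_k(y)) + u(y)·1ᵀ` is a four-variable linear pencil and `Per_ij` its sub-permanents
(closed form `Theorems/ValuativeGCTHeadFlipSubpermDiagRankOne.lean`).

This file fixes the EXPLICIT pencil used by the certificate and the auxiliary polynomials of its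
proof (lead's blueprint `RANKBOUND-BLUEPRINT.md` in the crux directory):
* the parameters `a_k = k + 1` (`rbA`), the forms `d_k = a_k·y₀ + y₃` (`rbD`, coefficient vector
  `rbDv`) and `u_k = a_k²·y₁ + a_k³·y₂` (`rbU`, `rbUv`) — the "moment-curve" pencil; variables
  `y₀..y₃ = X 0..X 3` of `MvPolynomial (Fin 4) ℂ`, `A = ⟨y₀, y₃⟩ ∋ d_k`, `B = ⟨y₁, y₂⟩ ∋ u_k`;
* the mixed elementary symmetric polynomials `e_s(T) = Σ_{S ⊆ T, |S| = s} u^S d^{T∖S}` (`rbE`,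
  shifted variant `rbEsh`), the closed-form minors `rbPer` (verbatim the shape of `stub_rankBound`),
  the products `Ψ(S) = Π_{k ∉ S} (d_k - u_k)` (`rbPsi`), the `2 × 2` minors
  `w_ab = d_a u_b - d_b u_a` (`rbW`);
* the special points `p_{ijk} = (e₂, e₁, -1, -e₃)` (`rbPt`; `e_r` the elementary symmetric
  functions of `a_i, a_j, a_k`), at which `d_l - u_l` takes the value `(a_l-a_i)(a_l-a_j)(a_l-a_k)`;
* the bookkeeping of a linear relation among the `3n²` generators `y_t · Per_ij`, `t ∈ {0, 3, 1}`
  (`rbMult`, `rbGen`): its `A`-part `ℓ_ab = c₀ y₀ + c₁ y₃` (`rbEll`), the symmetrised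
  `q_ab = ℓ_ab u_b + ℓ_ba u_a` (`rbQq`), and the weight-graded pieces `W_t`, `P_s` (`rbWt`, `rbPs`)
  of the relation (weight = degree in the `B`-variables `y₁, y₂`).
One theorem (`stub_rbPtSpec`, the values of `d_l - u_l` at the special points), the rest are
definitions. [this crux; new]
-/

-- `Summit.ValiantsHypothesis.ValiantsHypothesis.…` is the tree's mandated single-conjunct layout (Sub = Summit).
set_option linter.dupNamespace false

namespace Summit.ValiantsHypothesis.ValiantsHypothesis.Theorems.HeadFlip

open MvPolynomial Finset
open scoped BigOperators

noncomputable section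

/-- The parameters of the explicit pencil: `a_k = k + 1` (distinct positive reals, as complex
numbers). [this crux] -/
def rbA {n : ℕ} (k : Fin n) : ℂ := ((k : ℕ) : ℂ) + 1

/-- Coefficient vector of the diagonal form `d_k = a_k·y₀ + y₃` (`t ↦` coefficient of `X t`), in
the format `d : Fin n → Fin 4 → ℂ` of `stub_rankBound`. [this crux] -/
def rbDv {n : ℕ} (k : Fin n) : Fin 4 → ℂ := ![rbA k, 0, 0, 1]

/-- Coefficient vector of the rank-one form `u_k = a_k²·y₁ + a_k³·y₂`, in the format
`u : Fin n → Fin 4 → ℂ` of `stub_rankBound`. [this crux] -/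
def rbUv {n : ℕ} (k : Fin n) : Fin 4 → ℂ := ![0, rbA k ^ 2, rbA k ^ 3, 0]

/-- The diagonal form `d_k = Σ_t rbDv k t · y_t = a_k·y₀ + y₃` (a form in `A = ⟨y₀, y₃⟩`).
[this crux] -/
def rbD {n : ℕ} (k : Fin n) : MvPolynomial (Fin 4) ℂ :=
  ∑ t : Fin 4, rbDv k t • (X t : MvPolynomial (Fin 4) ℂ)

/-- The rank-one form `u_k = Σ_t rbUv k t · y_t = a_k²·y₁ + a_k³·y₂` (a form in `B = ⟨y₁, y₂⟩`).
[this crux] -/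
def rbU {n : ℕ} (k : Fin n) : MvPolynomial (Fin 4) ℂ :=
  ∑ t : Fin 4, rbUv k t • (X t : MvPolynomial (Fin 4) ℂ)

/-- The mixed elementary symmetric polynomial `e_s(T) = Σ_{S ⊆ T, |S| = s} (Π_{k∈S} u_k)(Π_{k∈T∖S} d_k)`
(the `x^s`-coefficient of `Π_{k∈T} (d_k + x·u_k)`; weighted-homogeneous of weight `s` in the
`B`-variables; `0` for `s > |T|`). [this crux] -/
def rbE {n : ℕ} (s : ℕ) (T : Finset (Fin n)) : MvPolynomial (Fin 4) ℂ :=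
  ∑ S ∈ T.powersetCard s, (∏ k ∈ S, rbU k) * ∏ k ∈ T \ S, rbD k

/-- Shifted `e`: `rbEsh s T = e_{s-1}(T)` for `s ≥ 1` and `0` for `s = 0` (avoids natural
subtraction in the weight bookkeeping). [this crux] -/
def rbEsh {n : ℕ} (s : ℕ) (T : Finset (Fin n)) : MvPolynomial (Fin 4) ℂ :=
  if s = 0 then 0 else rbE (s - 1) T

/-- The closed-form sub-permanents of the pencil `diag(d) + u·1ᵀ`, in exactly the shape of
`stub_rankBound` (powerset sums with factorial weights): `Per_ii = Σ_{S ⊆ [n]∖{i}} |S|!·u^S·d^∁`,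
`Per_ij = u_j · Σ_{S ⊆ [n]∖{i,j}} (|S|+1)!·u^S·d^∁` (`i ≠ j`); equal to `∂_{(i,j)} per_n` on the pencil
by `stub_subpermDiagRankOne`. [this crux] -/
def rbPer {n : ℕ} (i j : Fin n) : MvPolynomial (Fin 4) ℂ :=
  if i = j then
    ∑ S ∈ (Finset.univ.erase i).powerset,
      (S.card.factorial : MvPolynomial (Fin 4) ℂ) * (∏ k ∈ S, rbU k) * ∏ k ∈ (Finset.univ.erase i) \ S, rbD k
  else
    rbU j * ∑ S ∈ ((Finset.univ.erase i).erase j).powerset,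
      ((S.card + 1).factorial : MvPolynomial (Fin 4) ℂ) * (∏ k ∈ S, rbU k) *
        ∏ k ∈ ((Finset.univ.erase i).erase j) \ S, rbD k

/-- `Ψ(S) = Π_{k ∉ S} (d_k - u_k)`: the value at `x = -1` of `Π_{k ∉ S} (d_k + x·u_k)`. [this crux] -/
def rbPsi {n : ℕ} (S : Finset (Fin n)) : MvPolynomial (Fin 4) ℂ :=
  ∏ k ∈ Finset.univ \ S, (rbD k - rbU k)

/-- The `2 × 2` minor `w_ab = d_a·u_b - d_b·u_a` (a bilinear form in `A ⊗ B`; `w_ab = 0` exactly on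
the quadric cone where `(d_a : d_b) = (u_a : u_b)`). [this crux] -/
def rbW {n : ℕ} (a b : Fin n) : MvPolynomial (Fin 4) ℂ := rbD a * rbU b - rbD b * rbU a

/-- The special point `p_{ijk} = (e₂, e₁, -1, -e₃) ∈ ℂ⁴` (coordinates `y₀, y₁, y₂, y₃`), `e_r` the
elementary symmetric functions of `a_i, a_j, a_k`: the common zero of `d_i - u_i`, `d_j - u_j`,
`d_k - u_k` (indeed `(d_l - u_l)(p_{ijk}) = (a_l - a_i)(a_l - a_j)(a_l - a_k)`). [this crux] -/
def rbPt {n : ℕ} (i j k : Fin n) : Fin 4 → ℂ :=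
  ![rbA i * rbA j + rbA i * rbA k + rbA j * rbA k, rbA i + rbA j + rbA k, -1,
    -(rbA i * rbA j * rbA k)]

/-- The three multipliers `y₀, y₃, y₁` (two in `A`, one in `B`) of the sub-family of generators used
by the certificate. [this crux] -/
def rbMult : Fin 3 → Fin 4 := ![0, 3, 1]

/-- The sub-family of generators `y_{rbMult t} · Per_ij`, indexed by `Fin 3 × (Fin n × Fin n)`.
[this crux] -/
def rbGen {n : ℕ} (ι : Fin 3 × (Fin n × Fin n)) : MvPolynomial (Fin 4) ℂ :=
  X (rbMult ι.1) * rbPer ι.2.1 ι.2.2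

/-- The `A`-part `ℓ_ab = c(0,(a,b))·y₀ + c(1,(a,b))·y₃` of a coefficient vector `c` of the
sub-family `rbGen` (so that `Σ_ι c ι · rbGen ι = Σ_ab (ℓ_ab + c(2,(a,b))·y₁)·Per_ab`). [this crux] -/
def rbEll {n : ℕ} (c : Fin 3 × (Fin n × Fin n) → ℂ) (a b : Fin n) : MvPolynomial (Fin 4) ℂ :=
  c (0, (a, b)) • (X 0 : MvPolynomial (Fin 4) ℂ) + c (1, (a, b)) • (X 3 : MvPolynomial (Fin 4) ℂ)

/-- The symmetrised quadratic `q_ab = ℓ_ab·u_b + ℓ_ba·u_a ∈ A ⊗ B` of a coefficient vector (the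
coefficient of `x·F_{-ab}` in the `x`-lift of the `A`-part of the relation). [this crux] -/
def rbQq {n : ℕ} (c : Fin 3 × (Fin n × Fin n) → ℂ) (a b : Fin n) : MvPolynomial (Fin 4) ℂ :=
  rbEll c a b * rbU b + rbEll c b a * rbU a

/-- The weight-`t` piece of the `x`-lift of the `A`-part of a relation:
`W_t = Σ_a ℓ_aa·e_t([n]∖a) + Σ_{a ≠ b} ℓ_ab·u_b·e_{t-1}([n]∖{a,b})` (the `t!`-rescaled
weight-`t` component of `Σ_ab ℓ_ab·Per_ab`; weight = degree in `y₁, y₂`). [this crux] -/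
def rbWt {n : ℕ} (c : Fin 3 × (Fin n × Fin n) → ℂ) (t : ℕ) : MvPolynomial (Fin 4) ℂ :=
  ∑ a : Fin n, rbEll c a a * rbE t (Finset.univ.erase a) +
    ∑ a : Fin n, ∑ b ∈ Finset.univ.erase a, rbEll c a b * rbU b * rbEsh t ((Finset.univ.erase a).erase b)

/-- The weight-`s` piece of the `x`-lift of the `y₁`-part of a relation:
`P_s = Σ_a μ_aa·e_s([n]∖a) + Σ_{a ≠ b} μ_ab·u_b·e_{s-1}([n]∖{a,b})`, `μ_ab = c(2,(a,b))` (the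
`s!`-rescaled weight-`s` component of `Σ_ab μ_ab·Per_ab`). [this crux] -/
def rbPs {n : ℕ} (c : Fin 3 × (Fin n × Fin n) → ℂ) (s : ℕ) : MvPolynomial (Fin 4) ℂ :=
  ∑ a : Fin n, c (2, (a, a)) • rbE s (Finset.univ.erase a) +
    ∑ a : Fin n, ∑ b ∈ Finset.univ.erase a, c (2, (a, b)) • (rbU b * rbEsh s ((Finset.univ.erase a).erase b))

/-- **stub_rbPtSpec** (registered sub-goal of `stub_rankBound`, line four-row-count of crux HeadFlip):
at the special point `p_{ijk}` every difference `d_l - u_l` takes the value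
`(a_l - a_i)(a_l - a_j)(a_l - a_k)` — so it vanishes exactly for `l ∈ {i, j, k}` (the cubic
`a ↦ y₃ + y₀ a - y₁ a² - y₂ a³` at `y = p_{ijk}` is `(a - a_i)(a - a_j)(a - a_k)`). [this crux] -/
theorem stub_rbPtSpec : ∀ {n : ℕ} (i j k l : Fin n),
    MvPolynomial.eval (rbPt i j k) (rbD l - rbU l) = (rbA l - rbA i) * (rbA l - rbA j) * (rbA l - rbA k) := by
  intro n i j k l
  simp only [rbD, rbU, rbDv, rbUv, rbPt, map_sub, Fin.sum_univ_four, Matrix.cons_val_zero,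
    Matrix.cons_val_one, Matrix.head_cons, Matrix.cons_val_two, Matrix.tail_cons,
    Matrix.cons_val_three]
  simp only [map_add, MvPolynomial.smul_eval, MvPolynomial.eval_X, Matrix.cons_val_zero,
    Matrix.cons_val_one, Matrix.head_cons, Matrix.cons_val_two, Matrix.tail_cons,
    Matrix.cons_val_three]
  ring

end

end Summit.ValiantsHypothesis.ValiantsHypothesis.Theorems.HeadFlip
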